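import Mathlib.Data.Sym.Card
import Summits.ValiantsHypothesis.ValiantsHypothesis.Theorems.KPlusLogSqLawTropicalCycleMonotone
import Summits.ValiantsHypothesis.ValiantsHypothesis.Theorems.KPlusLogSqLawTropicalBSplitDefs

/-!
# Route «KPlusLogSqLaw», crux `TropicalB` (stmt-ValiantsHypothesis-19771) — the LOCAL PATTERN LAW: BOUNDED EXCHANGE CYCLES ARE POLYNOMIAL
# `n ≤ #J + Σ_{ℓ ≤ c} C(m,ℓ)²·multichoose(K,ℓ)` in EVERY design (`J` ⊇ the steps with an orbit of more than `c` columns)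

HONEST FRAMING.  Helper toward the registered stubs `stub_tropThin` / `stub_tropFat` of `Cruxes/TropicalB/Lines/birth.lean` (crux
`Summit.ValiantsHypothesis.ValiantsHypothesis.Theses.KPlusLogSqLaw.TropicalB`, item stmt-ValiantsHypothesis-19771, route KPlusLogSqLaw; cell
`pub-symmetroid`, seat val-sym-trop-p1 g25, 2026-08-29; `--supports … --as helper`).  A STRUCTURE law for dominant chains of ARBITRARY designs; it
does not bound `TropicalB` in its window (long cycles escape) and bears on neither `WeakLifting`, DoorA26 / DoorA34, `MatrixDescartes`
(stmt-ValiantsHypothesis-18050) nor VP ≠ VNP.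

A SITE is a pair `(B, A)` of a column set and a row set of the same size `ℓ`; a term `(σ, λ)` OCCUPIES the site if `σ(B) = A`, and its LOCAL
PATTERN there is `(σ|_B, λ|_B)`, with local mass `Σ_{b∈B} d(λ b)`.

* `invariant_of_image_eq` — two terms occupying the same site have a quotient `σ₁⁻¹σ₂` leaving `B` invariant; so the tree's cyclewise
  monotonicity (`sum_d_lt_of_isDominant_invariant`, p-CycleMonotone) applies to ANY two chain terms occupying a site, not only consecutive ones:
  `localMass_lt_of_occupy` — **along a dominant chain the local patterns seen at a site appear in STRICTLY INCREASING local mass** (a pattern never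
  returns once another pattern has occupied the site).
* `card_siteSteps_le` — hence the steps `k` at which `B` is an invariant set of `σ_k⁻¹σ_{k+1}` with `σ_k(B) = A` and some column of `B` changes
  are at most `multichoose K #B` (their local class multisets are pairwise distinct — injective into `Sym (Fin K) #B`).
* **`chain_le_localPattern`** — charging every step outside `J` to an invariant orbit-set of `≤ c` columns through a changed column:
  **`n ≤ #J + Σ_{ℓ=0}^{c} C(m,ℓ)²·multichoose(K,ℓ)`** for every design, every chain, every `J` outside which all orbits have `≤ c` columns;
  `chain_le_localPattern_pure` (`J = ∅`).  POLYNOMIAL in `m` and `K` for fixed `c` (`≤ (c+1)·m^{2c}·(K+c)^c`), against the exponent-free cycle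
  potential law's `m·(2c+1)^K` (`…TropicalBCyclePotentialAllK`, better only for `K = O(log m)`) and slope counting's `multichoose K m`.
READING.  Chains whose exchange cycles stay bounded are polynomially short in every design; a family violating `TropicalB` must make
super-quasi-polynomially many steps along cycles of length `> c` for EVERY fixed `c` — indeed for `c` of order `(K + log² m)/log(mK)`.  Ends of the law:
`c = 1` is the class-flip budget `m²(K−1)`-type count (lift-p2's permutation budget), `c = m` is slope counting weakened by `C(m,ℓ)²`; the sibling
for a FIXED column partition is val-sym-trop-p4's block-image law (`…TropicalBBlockImageLaw`).
[this cell's law; the monotonicity is the tree's exchange inequality]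
-/

set_option linter.dupNamespace false
set_option autoImplicit false

namespace Summit.ValiantsHypothesis.ValiantsHypothesis.Theorems.KPlusLogSqLaw

open Summit.ValiantsHypothesis.ValiantsHypothesis.Theorems.MatrixDescartes.Negative
open scoped BigOperators
open Finset

namespace LocalPattern

variable {m K : ℕ}

/-- two permutations with the same image of `B` have a quotient leaving `B` invariant. [folklore] -/
theorem invariant_of_image_eq {σ₁ σ₂ : Equiv.Perm (Fin m)} {B : Finset (Fin m)} (h : B.image σ₁ = B.image σ₂) :
    ∀ x, (σ₁⁻¹ * σ₂) x ∈ B ↔ x ∈ B := by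
  classical
  intro x
  rw [Equiv.Perm.mul_apply]
  constructor
  · intro hx
    have h1 : σ₁ ((σ₁⁻¹) (σ₂ x)) ∈ B.image σ₁ := mem_image_of_mem _ hx
    have h2 : σ₁ ((σ₁⁻¹) (σ₂ x)) = σ₂ x := by simp
    rw [h2, h] at h1
    obtain ⟨y, hy, hyx⟩ := mem_image.mp h1
    rwa [← σ₂.injective hyx]
  · intro hx
    have h1 : σ₂ x ∈ B.image σ₁ := by rw [h]; exact mem_image_of_mem _ hx
    obtain ⟨y, hy, hyx⟩ := mem_image.mp h1
    have : σ₁⁻¹ (σ₂ x) = y := by rw [← hyx]; simp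
    rw [this]; exact hy

/-- an invariant set has the same image under both permutations. [folklore] -/
theorem image_eq_of_invariant {σ₁ σ₂ : Equiv.Perm (Fin m)} {B : Finset (Fin m)} (h : ∀ x, (σ₁⁻¹ * σ₂) x ∈ B ↔ x ∈ B) :
    B.image σ₁ = B.image σ₂ := by
  classical
  ext a
  simp only [mem_image]
  constructor
  · rintro ⟨y, hy, rfl⟩
    -- `y = (σ₁⁻¹σ₂) x` for `x = σ₂⁻¹ σ₁ y`, and `x ∈ B`
    refine ⟨σ₂⁻¹ (σ₁ y), ?_, by simp⟩
    have : (σ₁⁻¹ * σ₂) (σ₂⁻¹ (σ₁ y)) = y := by simp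
    exact (h _).mp (by rw [this]; exact hy)
  · rintro ⟨x, hx, rfl⟩
    exact ⟨(σ₁⁻¹ * σ₂) x, (h x).mpr hx, by simp⟩

variable (d : Fin K → ℕ) (v ε : Fin m → Fin m → Fin K → ℤ)

/-- **Local mass monotonicity at a site.**  If two terms of a dominant chain, at slopes `θ k₁ < θ k₂`, occupy the same site (`σ_{k₁}(B) = σ_{k₂}(B)`)
with different local patterns on `B`, the local mass strictly increases. [tree's exchange inequality, repackaged] -/
theorem localMass_lt_of_occupy {n : ℕ} (θ : Fin (n + 1) → ℤ) (p : Fin (n + 1) → Equiv.Perm (Fin m) × (Fin m → Fin K))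
    (hθ : StrictMono θ) (hdom : ∀ k, IsDominant d v ε (θ k) (p k)) {k₁ k₂ : Fin (n + 1)} (hk : k₁ < k₂) (B : Finset (Fin m))
    (himg : B.image (p k₁).1 = B.image (p k₂).1) (hne : ∃ b ∈ B, (p k₁).1 b ≠ (p k₂).1 b ∨ (p k₁).2 b ≠ (p k₂).2 b) :
    ∑ b ∈ B, (d ((p k₁).2 b) : ℤ) < ∑ b ∈ B, (d ((p k₂).2 b) : ℤ) :=
  sum_d_lt_of_isDominant_invariant d v ε (hθ hk) (hdom k₁) (hdom k₂) B (invariant_of_image_eq himg) hne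

/-- local mass is monotone (weakly) between two occupations of a site. -/
theorem localMass_le_of_occupy {n : ℕ} (θ : Fin (n + 1) → ℤ) (p : Fin (n + 1) → Equiv.Perm (Fin m) × (Fin m → Fin K))
    (hθ : StrictMono θ) (hdom : ∀ k, IsDominant d v ε (θ k) (p k)) {k₁ k₂ : Fin (n + 1)} (hk : k₁ ≤ k₂) (B : Finset (Fin m))
    (himg : B.image (p k₁).1 = B.image (p k₂).1) :
    ∑ b ∈ B, (d ((p k₁).2 b) : ℤ) ≤ ∑ b ∈ B, (d ((p k₂).2 b) : ℤ) := by
  classical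
  rcases hk.lt_or_eq with hlt | heq
  · by_cases hne : ∃ b ∈ B, (p k₁).1 b ≠ (p k₂).1 b ∨ (p k₁).2 b ≠ (p k₂).2 b
    · exact (localMass_lt_of_occupy d v ε θ p hθ hdom hlt B himg hne).le
    · push Not at hne
      exact (sum_congr rfl fun b hb => by rw [(hne b hb).2]).le
  · rw [heq]

/-- the class multiset of a term on a column set `B`, as an element of `Sym (Fin K) #B`. -/
theorem card_map_eq (B : Finset (Fin m)) (l : Fin m → Fin K) : (B.val.map l).card = B.card := by simp

/-- **At most `multichoose K #B` charged steps per site.**  The steps `k` with `σ_k(B) = A`, `B` invariant under `σ_k⁻¹σ_{k+1}`, and some column of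
`B` changed, have pairwise distinct local class multisets on `B` (their local masses strictly increase), hence number at most `multichoose K #B`.
[this cell's law] -/
theorem card_siteSteps_le {n : ℕ} (θ : Fin (n + 1) → ℤ) (p : Fin (n + 1) → Equiv.Perm (Fin m) × (Fin m → Fin K))
    (hθ : StrictMono θ) (hdom : ∀ k, IsDominant d v ε (θ k) (p k)) (B A : Finset (Fin m)) :
    (univ.filter fun k : Fin n => B.image (p k.castSucc).1 = A ∧ (∀ x, ((p k.castSucc).1⁻¹ * (p k.succ).1) x ∈ B ↔ x ∈ B) ∧
      ∃ b ∈ B, (p k.castSucc).1 b ≠ (p k.succ).1 b ∨ (p k.castSucc).2 b ≠ (p k.succ).2 b).card ≤ Nat.multichoose K B.card := by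
  classical
  set S := univ.filter fun k : Fin n => B.image (p k.castSucc).1 = A ∧ (∀ x, ((p k.castSucc).1⁻¹ * (p k.succ).1) x ∈ B ↔ x ∈ B) ∧
      ∃ b ∈ B, (p k.castSucc).1 b ≠ (p k.succ).1 b ∨ (p k.castSucc).2 b ≠ (p k.succ).2 b with hS
  -- local mass is strictly increasing along `S`
  have hmass : ∀ k₁ ∈ S, ∀ k₂ ∈ S, k₁ < k₂ →
      ∑ b ∈ B, (d ((p k₁.castSucc).2 b) : ℤ) < ∑ b ∈ B, (d ((p k₂.castSucc).2 b) : ℤ) := by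
    intro k₁ hk₁ k₂ hk₂ hlt
    obtain ⟨himg₁, hinv₁, hne₁⟩ := (mem_filter.mp hk₁).2
    obtain ⟨himg₂, -, -⟩ := (mem_filter.mp hk₂).2
    -- step `k₁`: strict increase (consecutive terms, `B` invariant, a change on `B`)
    have h1 : ∑ b ∈ B, (d ((p k₁.castSucc).2 b) : ℤ) < ∑ b ∈ B, (d ((p k₁.succ).2 b) : ℤ) :=
      sum_d_lt_of_isDominant_invariant d v ε (hθ Fin.castSucc_lt_succ) (hdom _) (hdom _) B hinv₁ hne₁
    -- from `k₁ + 1` to `k₂`: both occupy the site `(B, A)`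
    have himg' : B.image (p k₁.succ).1 = B.image (p k₂.castSucc).1 := by
      rw [← image_eq_of_invariant hinv₁, himg₁, himg₂]
    have hle : k₁.succ ≤ k₂.castSucc := by
      rw [Fin.le_def]; simp only [Fin.val_succ, Fin.val_castSucc]; exact hlt
    have h2 := localMass_le_of_occupy d v ε θ p hθ hdom hle B himg'
    exact lt_of_lt_of_le h1 h2
  -- hence the local class multisets are pairwise distinct
  have hinj : Set.InjOn (fun k : Fin n => (⟨B.val.map (p k.castSucc).2, card_map_eq B _⟩ : Sym (Fin K) B.card)) S := by
    intro k₁ hk₁ k₂ hk₂ heq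
    have hsum : ∑ b ∈ B, (d ((p k₁.castSucc).2 b) : ℤ) = ∑ b ∈ B, (d ((p k₂.castSucc).2 b) : ℤ) := by
      have h := congrArg (fun M : Sym (Fin K) B.card => ((M : Multiset (Fin K)).map fun l => (d l : ℤ)).sum) heq
      simp only [Sym.coe_mk, Multiset.map_map] at h
      rw [Finset.sum_eq_multiset_sum, Finset.sum_eq_multiset_sum]
      exact h
    by_contra hne
    rcases lt_or_gt_of_ne hne with hlt | hlt
    · exact absurd hsum (ne_of_lt (hmass k₁ hk₁ k₂ hk₂ hlt))
    · exact absurd hsum.symm (ne_of_lt (hmass k₂ hk₂ k₁ hk₁ hlt))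
  have hcard : S.card ≤ Fintype.card (Sym (Fin K) B.card) := by
    rw [← Fintype.card_coe]
    refine Fintype.card_le_of_injective
      (fun k : S => (⟨B.val.map (p k.1.castSucc).2, card_map_eq B _⟩ : Sym (Fin K) B.card)) ?_
    intro k₁ k₂ h
    exact Subtype.ext (hinj k₁.2 k₂.2 h)
  rwa [Sym.card_sym_eq_multichoose, Fintype.card_fin] at hcard

/-- **THE LOCAL PATTERN LAW.**  In every design, for every chain of terms dominant at strictly increasing slopes with consecutive terms distinct, and
every set `J` of steps outside which each column lies in an invariant set of at most `c` columns of the exchange quotient: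
`n ≤ #J + Σ_{ℓ=0}^{c} C(m,ℓ)²·multichoose(K,ℓ)`. [this cell's law] -/
theorem chain_le_localPattern (c : ℕ) {n : ℕ} (θ : Fin (n + 1) → ℤ) (p : Fin (n + 1) → Equiv.Perm (Fin m) × (Fin m → Fin K))
    (hθ : StrictMono θ) (hdom : ∀ k, IsDominant d v ε (θ k) (p k)) (hne : ∀ k : Fin n, p k.castSucc ≠ p k.succ)
    (J : Finset (Fin n))
    (horb : ∀ k : Fin n, k ∉ J → ∀ b : Fin m, ∃ T : Finset (Fin m), b ∈ T ∧ T.card ≤ c ∧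
      ∀ x, ((p k.castSucc).1⁻¹ * (p k.succ).1) x ∈ T ↔ x ∈ T) :
    n ≤ J.card + ∑ ℓ ∈ range (c + 1), (m.choose ℓ) ^ 2 * Nat.multichoose K ℓ := by
  classical
  -- the charged site of a step outside `J`
  have hsite : ∀ k : Fin n, k ∉ J → ∃ T : Finset (Fin m), T.card ≤ c ∧ (∀ x, ((p k.castSucc).1⁻¹ * (p k.succ).1) x ∈ T ↔ x ∈ T) ∧
      ∃ b ∈ T, (p k.castSucc).1 b ≠ (p k.succ).1 b ∨ (p k.castSucc).2 b ≠ (p k.succ).2 b := by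
    intro k hk
    -- some column changes
    obtain ⟨b, hb⟩ : ∃ b, (p k.castSucc).1 b ≠ (p k.succ).1 b ∨ (p k.castSucc).2 b ≠ (p k.succ).2 b := by
      by_contra hall
      push Not at hall
      exact hne k (Prod.ext (Equiv.ext fun b => (hall b).1) (funext fun b => (hall b).2))
    obtain ⟨T, hbT, hTc, hTinv⟩ := horb k hk b
    exact ⟨T, hTc, hTinv, b, hbT, hb⟩
  choose! site hsite_card hsite_inv hsite_ch using hsite
  -- the sites: pairs (B, A) with #B ≤ c and #A = #B
  set Sites : Finset (Finset (Fin m) × Finset (Fin m)) :=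
    univ.filter fun BA => BA.1.card ≤ c ∧ BA.2.card = BA.1.card with hSites
  set f : Fin n → Finset (Fin m) × Finset (Fin m) := fun k => (site k, (site k).image (p k.castSucc).1) with hf
  have hmaps : ∀ k ∈ univ \ J, f k ∈ Sites := by
    intro k hk
    rw [hSites, mem_filter]
    exact ⟨mem_univ _, hsite_card k (mem_sdiff.mp hk).2, card_image_of_injective _ (p k.castSucc).1.injective⟩
  -- count the complement of `J` fibrewise over the sites
  have hcount : (univ \ J).card = ∑ BA ∈ Sites, ((univ \ J).filter fun k => f k = BA).card :=
    card_eq_sum_card_fiberwise hmaps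
  have hfib : ∀ BA ∈ Sites, ((univ \ J).filter fun k => f k = BA).card ≤ Nat.multichoose K BA.1.card := by
    intro BA _
    refine le_trans (card_le_card ?_) (card_siteSteps_le d v ε θ p hθ hdom BA.1 BA.2)
    intro k hk
    rw [mem_filter] at hk ⊢
    obtain ⟨hk1, hk2⟩ := hk
    have hkJ : k ∉ J := (mem_sdiff.mp hk1).2
    subst hk2
    exact ⟨mem_univ _, rfl, hsite_inv k hkJ, hsite_ch k hkJ⟩
  -- the sites with `#B = ℓ` are `powersetCard ℓ univ × powersetCard ℓ univ`
  have hSites_fibre : ∀ ℓ ∈ range (c + 1), (Sites.filter fun BA => BA.1.card = ℓ).card = (m.choose ℓ) ^ 2 := by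
    intro ℓ hℓ
    have hℓc : ℓ ≤ c := Nat.lt_succ_iff.mp (mem_range.mp hℓ)
    have heq : (Sites.filter fun BA => BA.1.card = ℓ) = (powersetCard ℓ (univ : Finset (Fin m))) ×ˢ (powersetCard ℓ univ) := by
      ext BA
      simp only [hSites, mem_filter, mem_univ, true_and, mem_product, mem_powersetCard, subset_univ]
      constructor
      · rintro ⟨⟨_, h2⟩, h3⟩; exact ⟨h3, by rw [h2, h3]⟩
      · rintro ⟨h1, h2⟩; exact ⟨⟨by rw [h1]; exact hℓc, by rw [h1, h2]⟩, h1⟩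
    rw [heq, card_product, card_powersetCard, card_univ, Fintype.card_fin, sq]
  have hsum : ∑ BA ∈ Sites, Nat.multichoose K BA.1.card ≤ ∑ ℓ ∈ range (c + 1), (m.choose ℓ) ^ 2 * Nat.multichoose K ℓ := by
    have hmaps' : ∀ BA ∈ Sites, BA.1.card ∈ range (c + 1) := by
      intro BA hBA
      rw [hSites, mem_filter] at hBA
      exact mem_range.mpr (Nat.lt_succ_of_le hBA.2.1)
    rw [← sum_fiberwise_of_maps_to hmaps']
    refine sum_le_sum fun ℓ hℓ => ?_
    rw [sum_congr rfl fun BA hBA => by rw [(mem_filter.mp hBA).2], sum_const, smul_eq_mul, hSites_fibre ℓ hℓ]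
  -- assemble
  have hJ : (univ \ J).card + J.card = n := by
    rw [card_sdiff_add_card_eq_card (subset_univ J), card_univ, Fintype.card_fin]
  have h1 : (univ \ J).card ≤ ∑ ℓ ∈ range (c + 1), (m.choose ℓ) ^ 2 * Nat.multichoose K ℓ := by
    rw [hcount]; exact (sum_le_sum hfib).trans hsum
  omega

/-- **Pure form** (`J = ∅`): a dominant chain all of whose exchange quotients have orbits of `≤ c` columns has
`n ≤ Σ_{ℓ=0}^{c} C(m,ℓ)²·multichoose(K,ℓ)` — polynomial in `m` and `K` for fixed `c`. [this cell's law] -/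
theorem chain_le_localPattern_pure (c : ℕ) {n : ℕ} (θ : Fin (n + 1) → ℤ) (p : Fin (n + 1) → Equiv.Perm (Fin m) × (Fin m → Fin K))
    (hθ : StrictMono θ) (hdom : ∀ k, IsDominant d v ε (θ k) (p k)) (hne : ∀ k : Fin n, p k.castSucc ≠ p k.succ)
    (horb : ∀ k : Fin n, ∀ b : Fin m, ∃ T : Finset (Fin m), b ∈ T ∧ T.card ≤ c ∧
      ∀ x, ((p k.castSucc).1⁻¹ * (p k.succ).1) x ∈ T ↔ x ∈ T) :
    n ≤ ∑ ℓ ∈ range (c + 1), (m.choose ℓ) ^ 2 * Nat.multichoose K ℓ := by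
  have h := chain_le_localPattern d v ε c θ p hθ hdom hne ∅ (fun k _ b => horb k b)
  simpa using h

/-- **Sign-alternating form** (hypothesis list of `TropicalCensus.TropRootLawAt`). [this cell's law] -/
theorem chain_le_localPattern_alt (c : ℕ) {n : ℕ} (θ : Fin (n + 1) → ℤ) (p : Fin (n + 1) → Equiv.Perm (Fin m) × (Fin m → Fin K))
    (hθ : StrictMono θ) (hdom : ∀ k, IsDominant d v ε (θ k) (p k))
    (halt : ∀ k : Fin n, termSign ε (p k.castSucc) * termSign ε (p k.succ) < 0)
    (horb : ∀ k : Fin n, ∀ b : Fin m, ∃ T : Finset (Fin m), b ∈ T ∧ T.card ≤ c ∧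
      ∀ x, ((p k.castSucc).1⁻¹ * (p k.succ).1) x ∈ T ↔ x ∈ T) :
    n ≤ ∑ ℓ ∈ range (c + 1), (m.choose ℓ) ^ 2 * Nat.multichoose K ℓ :=
  chain_le_localPattern_pure d v ε c θ p hθ hdom (ne_succ_of_alternating ε p halt) horb

end LocalPattern

end Summit.ValiantsHypothesis.ValiantsHypothesis.Theorems.KPlusLogSqLaw
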